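import Summits.Ventures.GridStability.Bench.SMIBDeg4AK13postD10Data
import Mathlib.Tactic.LinearCombination
import Mathlib.Tactic.Positivity
import HarnessLib
-- PORT cert/sos-5/emit_lean.py@5fb0ce3d58466585 / source cert/A/SMIB-deg4-A-K13postD10.json sha256: fe805a5f28e14305e50b71020fa8858ad3149da29260158583230bc9d4f11665

/-!
# Ventures/GridStability — Bench/SMIBDeg4AK13postD10.lean: certificate file `SMIB-deg4-A-K13postD10` (system SMIB, V degree 4, toolchain A)

HONEST FRAMING (LADDER-GRIDFUSION; three columns never merged; quoted from the certificate file's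
`columns`). CERTIFIED: the 4 polynomial identities below (Gram-form Positivstellensatz, exact
rational data, every Gram matrix PSD by exact LDL^T): V - eps_pos*phi >= 0 on {h=0}; -Vdot -
eps_dot*phi >= 0, r2 - phi >= 0 and kappa_max - kappa >= 0 on {level - V >= 0} cap {h=0}. Algebraic
inequalities certified; ROA inclusion pending Lyapunov/ lemma. — re-derived IN THE KERNEL (`decide
+kernel`) from the Gram-form SOS / Positivstellensatz certificate (data in
`Summits.Ventures.GridStability.Bench.SMIBDeg4AK13postD10Data`) by the tree's once-proved checker
`Literature.Computation.Certificates.SOS.Poly.nonneg_of_checkG`. VALIDATED: float SDP solves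
(certsdp 0.1.1 / clarabel) located V and the level; margins and solver status are provenance only
MODELLED: M' = classical SMIB (model-1 Summit.Ventures.GridStability.Models.SMIB, polyField a b d)
at Kundur Ex. 13.1 post-fault plant with P_m' = 79912287/88791425 (eq=b, t = 1225/2367) and K_D = 10
from Ex. 12.2 variant (iii) (instance SMIB-K13post-D10); MODEL-VALIDITY MV-1

MODEL BLOCK (self-contained restatement of interface I2; model `SMIB instance SMIB-K13post-D10
(model-1 I2 file, f verbatim)`, instance `SMIB-K13post-D10`; equilibrium: PARTITION A1, deviation
coordinates (model-1 pick 2026-08-26T16:2xZ): u = δ − δ*, z = (σ, κ, ω) = (sin u, 1 − cos u, ω), ω =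
dδ/dt in rad/s (deviation from synchronous speed); SOS.Poly variable indices σ↦0, κ↦1, ω↦2; printed
recast Kundu–Anghel ECC 2015 (arXiv:1503.07541) §6.2 | z = 0 exactly (f has no constant terms);
parameters: a = 532761715096/15538499375 [Kundur Ex. 12.2 variant (iii) K_D = 10.0 (same plant;
MODELLED choice for an ATTRACTIVE certificate)]; b = 4303847457/88791425 [Kundur Ex. 12.2 variant
(iii) K_D = 10.0 (same plant; MODELLED choice for an ATTRACTIVE certificate)]; d = 10/7 [Kundur Ex.
12.2 variant (iii) K_D = 10.0 (same plant; MODELLED choice for an ATTRACTIVE certificate)]; K_D = 10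
[Kundur Ex. 12.2 variant (iii) K_D = 10.0 (same plant; MODELLED choice for an ATTRACTIVE
certificate)]). The vector field `f`, the constraints `h` and `V` are EXACTLY the certificate file's
polynomials (the emitter refuses files with f(0) ≠ 0, h(0) ≠ 0 or `Vdot ≠ ∇V·f`); model-1's decls:
SMIB.polyField a b d = [fσ, fκ, fω a b d].

THREE-COLUMN RULE (README §3 T7, PARTITION A2): no sentence of this file asserts stability of
anything; such a sentence would name the model M AND a perturbation class C. These are ALGEBRAIC
inequalities: «algebraic inequalities certified; ROA inclusion pending Lyapunov/ lemma» — the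
ODE-level reading (sublevel set {V ≤ level} ∩ {h = 0} positively invariant / attracted, for model
M′) is sub-rung G1.<system>-roa (the `…Roa.lean` companion via
`Summit.Ventures.GridStability.Lyapunov.CertificateSoundness`). Domain polys: `-1/36*omega^2 -
kappa^2 - sigma^2 + 1 ≥ 0`; level: 31/10; ball r²: 1; arc exclusion: kappa ≤ 1; V degree: 4;
programme shape: stage A: V synthesised with -Vdot - 2*eps_dot*phi SOS on the ball {phi <= r2} mod h
(degree 4); stage B/C: V rounded to 1/10000 and FIXED, level c by float bisection then backed off to
a nice rational; Putinar multipliers on (c - V); three identities from ONE final SDP with margin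
objective.

IDENTITIES (README §3 T3 shape; theorem names `SMIB.deg4_A_K13postD10_<identity>` per CERT-FORMAT §5):
* `deg4_A_K13postD10_V_pos` (V_pos): V - eps_pos*phi >= 0 on {h = 0} — on {h[0] = 0}; Gram blocks 9
(psd dd); `p` has 32 terms, degree 4.
* `deg4_A_K13postD10_Vdot_neg` (Vdot_neg): -Vdot - eps_dot*phi >= 0 on {level - V >= 0} cap {h = 0}
(Vdot = grad V . f) — on {level − V ≥ 0, h[0] = 0}; Gram blocks 19;3 (psd dd;dd); `p` has 45 terms,
degree 5.
* `deg4_A_K13postD10_level_in_ball` (level_in_ball): r2 - phi >= 0 on {level - V >= 0} cap {h = 0}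
(typed inclusion {V <= level} cap {h=0} in D = {phi <= r2}, PARTITION A2) — on {level − V ≥ 0, h[0]
= 0}; Gram blocks 20;4 (psd dd;dd); `p` has 4 terms, degree 2.
* `deg4_A_K13postD10_arc_excl` (arc_excl): kappa_max - kappa >= 0 on {level - V >= 0} cap {h = 0}
(arc exclusion kappa = 1 - cos(u) <= kappa_max < 2: director RULING 3 (4) / MODEL-VALIDITY MV-1(e))
— on {level − V ≥ 0, h[0] = 0}; Gram blocks 20;4 (psd dd;dd); `p` has 2 terms, degree 1.
* `deg4_A_K13postD10_certificate`: the conjunction.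

PROVENANCE (VALIDATED-class, never part of the claim): toolchain A, seat gridfusion-sos-1; engine
certsdp 0.1.1 (backend clarabel); kit job j257183 (tag gridfusion, 2 cores, wall ? s, core-h ?);
rounding: Peyrl-Parrilo: round every unknown to denominator N, then project onto each identity's
coe, denominator 1048576; exact check: in-job assemble_identity (residual zero + LDL^T per block)
and gfsos/exactcheck.py; created 2026-08-26T17:33:57Z; certificate file `SMIB-deg4-A-K13postD10`
canonical sha256 61ff7212bb3a3c0c… (check PASS), file bytes sha256 fe805a5f28e14305…; emitted by
HOME/cert/sos-5/emit_lean.py v0.3 (5fb0ce3d58466585) in mode mono. Variables (x 0, x 1, …) = (sigma,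
kappa, omega), Lean binders (sigma, kappa, omega).
-/

namespace Summit.Ventures.GridStability.Bench.SMIB

open Literature.Computation.Certificates Literature.Computation.Certificates.SOS
open Literature.Computation.Certificates.SOS.Poly

/-! ### Kernel checks (`decide +kernel`) — data in `Summits.Ventures.GridStability.Bench.SMIBDeg4AK13postD10Data` -/

set_option maxHeartbeats 0 in
/-- KERNEL CHECK `deg4_A_K13postD10_V_pos`: every Gram block passes `PSD.IsGramCertDD` and the residual `p − (σ₀ + Σ gᵢσᵢ + Σ hⱼtⱼ)` is the zero polynomial (`SOS.Poly.checkG`, ONE reduction). [folklore] -/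
theorem deg4_A_K13postD10_V_pos_check : checkG deg4_A_K13postD10_V_pos_p deg4_A_K13postD10_V_pos_gs deg4_A_K13postD10_V_pos_hs deg4_A_K13postD10_V_pos_cert = true := by
  decide +kernel

set_option maxHeartbeats 0 in
/-- KERNEL CHECK `deg4_A_K13postD10_Vdot_neg`: every Gram block passes `PSD.IsGramCertDD` and the residual `p − (σ₀ + Σ gᵢσᵢ + Σ hⱼtⱼ)` is the zero polynomial (`SOS.Poly.checkG`, ONE reduction). [folklore] -/
theorem deg4_A_K13postD10_Vdot_neg_check : checkG deg4_A_K13postD10_Vdot_neg_p deg4_A_K13postD10_Vdot_neg_gs deg4_A_K13postD10_Vdot_neg_hs deg4_A_K13postD10_Vdot_neg_cert = true := by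
  decide +kernel

set_option maxHeartbeats 0 in
/-- KERNEL CHECK `deg4_A_K13postD10_level_in_ball`: every Gram block passes `PSD.IsGramCertDD` and the residual `p − (σ₀ + Σ gᵢσᵢ + Σ hⱼtⱼ)` is the zero polynomial (`SOS.Poly.checkG`, ONE reduction). [folklore] -/
theorem deg4_A_K13postD10_level_in_ball_check : checkG deg4_A_K13postD10_level_in_ball_p deg4_A_K13postD10_level_in_ball_gs deg4_A_K13postD10_level_in_ball_hs deg4_A_K13postD10_level_in_ball_cert = true := by
  decide +kernel

set_option maxHeartbeats 0 in
/-- KERNEL CHECK `deg4_A_K13postD10_arc_excl`: every Gram block passes `PSD.IsGramCertDD` and the residual `p − (σ₀ + Σ gᵢσᵢ + Σ hⱼtⱼ)` is the zero polynomial (`SOS.Poly.checkG`, ONE reduction). [folklore] -/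
theorem deg4_A_K13postD10_arc_excl_check : checkG deg4_A_K13postD10_arc_excl_p deg4_A_K13postD10_arc_excl_gs deg4_A_K13postD10_arc_excl_hs deg4_A_K13postD10_arc_excl_cert = true := by
  decide +kernel

/-! ### The certified inequalities (README §3 T3; «algebraic inequalities certified; ROA inclusion pending Lyapunov/ lemma») -/

/-- **`deg4_A_K13postD10_V_pos`** (CERTIFIED, model `SMIB instance SMIB-K13post-D10 (model-1 I2 file, f
verbatim)`; ALGEBRAIC inequality, ROA inclusion pending Lyapunov/ lemma): V - eps_pos*phi >= 0 on {h
= 0} — for every real point satisfying the listed hypotheses (hh). [folklore] -/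
theorem deg4_A_K13postD10_V_pos (sigma kappa omega : ℝ) (hh : deg4_A_K13postD10_h sigma kappa omega = 0) :
    (1 / 100 : ℝ) * (((1 : ℝ) / 36) * omega ^ 2 + (1 : ℝ) * kappa ^ 2 + (1 : ℝ) * sigma ^ 2) ≤ deg4_A_K13postD10_V sigma kappa omega := by
  simp only [deg4_A_K13postD10_V]
  simp only [deg4_A_K13postD10_h] at hh
  have h := nonneg_of_checkG deg4_A_K13postD10_V_pos_check (vars [sigma, kappa, omega])
    (by simp [deg4_A_K13postD10_V_pos_gs])
    (by
      intro q hq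
      simp only [deg4_A_K13postD10_V_pos_hs, List.mem_cons, List.not_mem_nil, or_false] at hq
      rcases hq with rfl
      · simp only [eval_cons, eval_nil, Monomial.eval_eq, Monomial.evalFrom_cons, Monomial.evalFrom_nil,
        vars_cons_zero, vars_cons_succ]
        push_cast
        linear_combination hh)
  simp only [deg4_A_K13postD10_V_pos_p, eval_cons, eval_nil, Monomial.eval_eq, Monomial.evalFrom_cons, Monomial.evalFrom_nil,
        vars_cons_zero, vars_cons_succ] at h
  push_cast at h
  linear_combination h

/-- **`deg4_A_K13postD10_Vdot_neg`** (CERTIFIED, model `SMIB instance SMIB-K13post-D10 (model-1 I2 file,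
f verbatim)`; ALGEBRAIC inequality, ROA inclusion pending Lyapunov/ lemma): -Vdot - eps_dot*phi >= 0
on {level - V >= 0} cap {h = 0} (Vdot = grad V . f) — for every real point satisfying the listed
hypotheses (hV, hh). [folklore] -/
theorem deg4_A_K13postD10_Vdot_neg (sigma kappa omega : ℝ) (hV : deg4_A_K13postD10_V sigma kappa omega ≤ (31 / 10 : ℝ)) (hh : deg4_A_K13postD10_h sigma kappa omega = 0) :
    deg4_A_K13postD10_Vdot sigma kappa omega ≤ -(1 / 2000 : ℝ) * (((1 : ℝ) / 36) * omega ^ 2 + (1 : ℝ) * kappa ^ 2 + (1 : ℝ) * sigma ^ 2) := by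
  simp only [deg4_A_K13postD10_Vdot, deg4_A_K13postD10_f_sigma, deg4_A_K13postD10_f_kappa, deg4_A_K13postD10_f_omega]
  simp only [deg4_A_K13postD10_V] at hV
  simp only [deg4_A_K13postD10_h] at hh
  have h := nonneg_of_checkG deg4_A_K13postD10_Vdot_neg_check (vars [sigma, kappa, omega])
    (by
      intro g hg
      simp only [deg4_A_K13postD10_Vdot_neg_gs, List.mem_cons, List.not_mem_nil, or_false] at hg
      rcases hg with rfl
      · simp only [eval_cons, eval_nil, Monomial.eval_eq, Monomial.evalFrom_cons, Monomial.evalFrom_nil,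
        vars_cons_zero, vars_cons_succ]
        push_cast
        linear_combination hV)
    (by
      intro q hq
      simp only [deg4_A_K13postD10_Vdot_neg_hs, List.mem_cons, List.not_mem_nil, or_false] at hq
      rcases hq with rfl
      · simp only [eval_cons, eval_nil, Monomial.eval_eq, Monomial.evalFrom_cons, Monomial.evalFrom_nil,
        vars_cons_zero, vars_cons_succ]
        push_cast
        linear_combination hh)
  simp only [deg4_A_K13postD10_Vdot_neg_p, eval_cons, eval_nil, Monomial.eval_eq, Monomial.evalFrom_cons, Monomial.evalFrom_nil,
        vars_cons_zero, vars_cons_succ] at h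
  push_cast at h
  linear_combination h

/-- **`deg4_A_K13postD10_level_in_ball`** (CERTIFIED, model `SMIB instance SMIB-K13post-D10 (model-1 I2
file, f verbatim)`; ALGEBRAIC inequality, ROA inclusion pending Lyapunov/ lemma): r2 - phi >= 0 on
{level - V >= 0} cap {h = 0} (typed inclusion {V <= level} cap {h=0} in D = {phi <= r2}, PARTITION
A2) — for every real point satisfying the listed hypotheses (hV, hh). [folklore] -/
theorem deg4_A_K13postD10_level_in_ball (sigma kappa omega : ℝ) (hV : deg4_A_K13postD10_V sigma kappa omega ≤ (31 / 10 : ℝ)) (hh : deg4_A_K13postD10_h sigma kappa omega = 0) :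
    ((1 : ℝ) / 36) * omega ^ 2 + (1 : ℝ) * kappa ^ 2 + (1 : ℝ) * sigma ^ 2 ≤ (1 : ℝ) := by
  simp only [deg4_A_K13postD10_V] at hV
  simp only [deg4_A_K13postD10_h] at hh
  have h := nonneg_of_checkG deg4_A_K13postD10_level_in_ball_check (vars [sigma, kappa, omega])
    (by
      intro g hg
      simp only [deg4_A_K13postD10_level_in_ball_gs, List.mem_cons, List.not_mem_nil, or_false] at hg
      rcases hg with rfl
      · simp only [eval_cons, eval_nil, Monomial.eval_eq, Monomial.evalFrom_cons, Monomial.evalFrom_nil,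
        vars_cons_zero, vars_cons_succ]
        push_cast
        linear_combination hV)
    (by
      intro q hq
      simp only [deg4_A_K13postD10_level_in_ball_hs, List.mem_cons, List.not_mem_nil, or_false] at hq
      rcases hq with rfl
      · simp only [eval_cons, eval_nil, Monomial.eval_eq, Monomial.evalFrom_cons, Monomial.evalFrom_nil,
        vars_cons_zero, vars_cons_succ]
        push_cast
        linear_combination hh)
  simp only [deg4_A_K13postD10_level_in_ball_p, eval_cons, eval_nil, Monomial.eval_eq, Monomial.evalFrom_cons, Monomial.evalFrom_nil,
        vars_cons_zero, vars_cons_succ] at h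
  push_cast at h
  linear_combination h

/-- **`deg4_A_K13postD10_arc_excl`** (CERTIFIED, model `SMIB instance SMIB-K13post-D10 (model-1 I2 file,
f verbatim)`; ALGEBRAIC inequality, ROA inclusion pending Lyapunov/ lemma): kappa_max - kappa >= 0
on {level - V >= 0} cap {h = 0} (arc exclusion kappa = 1 - cos(u) <= kappa_max < 2: director RULING
3 (4) / MODEL-VALIDITY MV-1(e)) — for every real point satisfying the listed hypotheses (hV, hh). [folklore] -/
theorem deg4_A_K13postD10_arc_excl (sigma kappa omega : ℝ) (hV : deg4_A_K13postD10_V sigma kappa omega ≤ (31 / 10 : ℝ)) (hh : deg4_A_K13postD10_h sigma kappa omega = 0) :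
    kappa ≤ (1 : ℝ) := by
  simp only [deg4_A_K13postD10_V] at hV
  simp only [deg4_A_K13postD10_h] at hh
  have h := nonneg_of_checkG deg4_A_K13postD10_arc_excl_check (vars [sigma, kappa, omega])
    (by
      intro g hg
      simp only [deg4_A_K13postD10_arc_excl_gs, List.mem_cons, List.not_mem_nil, or_false] at hg
      rcases hg with rfl
      · simp only [eval_cons, eval_nil, Monomial.eval_eq, Monomial.evalFrom_cons, Monomial.evalFrom_nil,
        vars_cons_zero, vars_cons_succ]
        push_cast
        linear_combination hV)
    (by
      intro q hq
      simp only [deg4_A_K13postD10_arc_excl_hs, List.mem_cons, List.not_mem_nil, or_false] at hq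
      rcases hq with rfl
      · simp only [eval_cons, eval_nil, Monomial.eval_eq, Monomial.evalFrom_cons, Monomial.evalFrom_nil,
        vars_cons_zero, vars_cons_succ]
        push_cast
        linear_combination hh)
  simp only [deg4_A_K13postD10_arc_excl_p, eval_cons, eval_nil, Monomial.eval_eq, Monomial.evalFrom_cons, Monomial.evalFrom_nil,
        vars_cons_zero, vars_cons_succ] at h
  push_cast at h
  linear_combination h

/-- **Certificate `SMIB-deg4-A-K13postD10`** (CERTIFIED, model `SMIB instance SMIB-K13post-D10 (model-1
I2 file, f verbatim)`; README §3 T3 shape): under the listed hypotheses (hh, hV) all 4 certified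
inequalities hold. «algebraic inequalities certified; ROA inclusion pending Lyapunov/ lemma»
(PARTITION A2). [folklore] -/
theorem deg4_A_K13postD10_certificate (sigma kappa omega : ℝ) (hh : deg4_A_K13postD10_h sigma kappa omega = 0) (hV : deg4_A_K13postD10_V sigma kappa omega ≤ (31 / 10 : ℝ)) :
    (1 / 100 : ℝ) * (((1 : ℝ) / 36) * omega ^ 2 + (1 : ℝ) * kappa ^ 2 + (1 : ℝ) * sigma ^ 2) ≤ deg4_A_K13postD10_V sigma kappa omega ∧
    deg4_A_K13postD10_Vdot sigma kappa omega ≤ -(1 / 2000 : ℝ) * (((1 : ℝ) / 36) * omega ^ 2 + (1 : ℝ) * kappa ^ 2 + (1 : ℝ) * sigma ^ 2) ∧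
    ((1 : ℝ) / 36) * omega ^ 2 + (1 : ℝ) * kappa ^ 2 + (1 : ℝ) * sigma ^ 2 ≤ (1 : ℝ) ∧
    kappa ≤ (1 : ℝ) :=
  ⟨deg4_A_K13postD10_V_pos sigma kappa omega hh, deg4_A_K13postD10_Vdot_neg sigma kappa omega hV hh, deg4_A_K13postD10_level_in_ball sigma kappa omega hV hh, deg4_A_K13postD10_arc_excl sigma kappa omega hV hh⟩

end Summit.Ventures.GridStability.Bench.SMIB
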